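import Summits.Ventures.PercRepro.C041TreeClosure

/-!
# STAR BOUNDS — the elementary inequalities between the six coordinates of a pure root `V a` (mine-3, gen 63)

For a star `a : Fin m → ℝ` with `0 ≤ a i ≤ 1` write `A = ∏ a i`, `B = ∏ (1 − a i)`, `P₁ = ∏ (1 + a i ^ 2)`,
`P₂ = ∏ (1 + (1 − a i) ^ 2)`; the pure root is `V a = (1, P₁, P₂, AB, A, B)` (`V_coords`).  This file collects the
one-leaf-at-a-time facts every certificate of the last seed needs: `0 ≤ A, B ≤ 1`, `1 ≤ P₁, P₂`,
`A · (1 − B) ≤ P₁ − 1` (`T₁ ≥ I₁`), `P₁ · B ≤ 1`, `1 + A ^ 2 ≤ P₁`, `A + B ≤ 1` for `m ≥ 1`, and their mirrors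
(`a ↦ 1 − a`), all by induction on the leaves (`Fin.prod_univ_castSucc`).
-/

namespace PercRepro

namespace TreeClosure

open Finset

/-- The product of numbers in `[0, 1]` lies in `[0, 1]`. -/
theorem prod_unit_mem {m : ℕ} (a : Fin m → ℝ) (ha : ∀ i, 0 ≤ a i ∧ a i ≤ 1) :
    0 ≤ ∏ i, a i ∧ ∏ i, a i ≤ 1 :=
  ⟨Finset.prod_nonneg (fun i _ => (ha i).1), Finset.prod_le_one (fun i _ => (ha i).1) (fun i _ => (ha i).2)⟩

/-- `1 ≤ ∏ (1 + a i ^ 2)`. -/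
theorem one_le_prod_one_add_sq {m : ℕ} (a : Fin m → ℝ) : 1 ≤ ∏ i, (1 + a i ^ 2) :=
  Finset.one_le_prod (fun i _ => by nlinarith [sq_nonneg (a i)])

/-- `A · (1 − B) ≤ P₁ − 1`: the invalid type-1 states of a star are at most its type-1 states. -/
theorem prod_mul_one_sub_prod_le {m : ℕ} (a : Fin m → ℝ) (ha : ∀ i, 0 ≤ a i ∧ a i ≤ 1) :
    (∏ i, a i) * (1 - ∏ i, (1 - a i)) ≤ ∏ i, (1 + a i ^ 2) - 1 := by
  induction m with
  | zero => simp
  | succ n ih =>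
    have ih' := ih (fun i => a (Fin.castSucc i)) (fun i => ha _)
    obtain ⟨hA0, hA1⟩ := prod_unit_mem (fun i : Fin n => a (Fin.castSucc i)) (fun i => ha _)
    obtain ⟨hB0, hB1⟩ := prod_unit_mem (fun i : Fin n => 1 - a (Fin.castSucc i))
      (fun i => ⟨by linarith [(ha (Fin.castSucc i)).2], by linarith [(ha (Fin.castSucc i)).1]⟩)
    have hP := one_le_prod_one_add_sq (fun i : Fin n => a (Fin.castSucc i))
    obtain ⟨hx0, hx1⟩ := ha (Fin.last n)
    simp only [Fin.prod_univ_castSucc] at ih' hA0 hA1 hB0 hB1 hP ⊢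
    set A := ∏ i : Fin n, a (Fin.castSucc i)
    set B := ∏ i : Fin n, (1 - a (Fin.castSucc i))
    set P := ∏ i : Fin n, (1 + a (Fin.castSucc i) ^ 2)
    set x := a (Fin.last n)
    nlinarith [mul_nonneg (mul_nonneg hA0 (by linarith : (0:ℝ) ≤ 1 - B)) (by nlinarith : (0:ℝ) ≤ 1 - x + x ^ 2),
      mul_nonneg (sq_nonneg x) (by nlinarith [mul_le_one₀ hA1 hB0 hB1] : (0:ℝ) ≤ 1 - A * B)]

/-- `P₁ · B ≤ 1`. -/
theorem prod_one_add_sq_mul_prod_one_sub_le_one {m : ℕ} (a : Fin m → ℝ) (ha : ∀ i, 0 ≤ a i ∧ a i ≤ 1) :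
    (∏ i, (1 + a i ^ 2)) * ∏ i, (1 - a i) ≤ 1 := by
  rw [← Finset.prod_mul_distrib]
  refine Finset.prod_le_one (fun i _ => ?_) (fun i _ => ?_)
  · obtain ⟨h0, h1⟩ := ha i
    exact mul_nonneg (by positivity) (by linarith)
  · obtain ⟨h0, h1⟩ := ha i
    nlinarith [mul_nonneg h0 (by nlinarith : (0:ℝ) ≤ 1 - a i + a i ^ 2)]

/-- `1 + A ^ 2 ≤ P₁` for a star with at least one leaf. -/
theorem one_add_prod_sq_le {m : ℕ} (a : Fin (m + 1) → ℝ) (ha : ∀ i, 0 ≤ a i ∧ a i ≤ 1) :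
    1 + (∏ i, a i) ^ 2 ≤ ∏ i, (1 + a i ^ 2) := by
  induction m with
  | zero =>
    simp only [Fin.prod_univ_castSucc, Fin.prod_univ_zero, one_mul]
    linarith
  | succ n ih =>
    have ih' := ih (fun i => a (Fin.castSucc i)) (fun i => ha _)
    obtain ⟨hA0, hA1⟩ := prod_unit_mem (fun i : Fin (n + 1) => a (Fin.castSucc i)) (fun i => ha _)
    obtain ⟨hx0, hx1⟩ := ha (Fin.last (n + 1))
    rw [Fin.prod_univ_castSucc (fun i => a i), Fin.prod_univ_castSucc (fun i => 1 + a i ^ 2)]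
    set A := ∏ i : Fin (n + 1), a (Fin.castSucc i)
    set P := ∏ i : Fin (n + 1), (1 + a (Fin.castSucc i) ^ 2)
    set x := a (Fin.last (n + 1))
    nlinarith [mul_nonneg (sq_nonneg x) (by nlinarith : (0:ℝ) ≤ 1 - A ^ 2), mul_nonneg (sq_nonneg A) (sq_nonneg x)]

/-- `A + B ≤ 1` for a star with at least one leaf. -/
theorem prod_add_prod_one_sub_le_one {m : ℕ} (a : Fin (m + 1) → ℝ) (ha : ∀ i, 0 ≤ a i ∧ a i ≤ 1) :
    (∏ i, a i) + ∏ i, (1 - a i) ≤ 1 := by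
  induction m with
  | zero =>
    simp only [Fin.prod_univ_castSucc, Fin.prod_univ_zero, one_mul]
    linarith
  | succ n ih =>
    have ih' := ih (fun i => a (Fin.castSucc i)) (fun i => ha _)
    obtain ⟨hA0, hA1⟩ := prod_unit_mem (fun i : Fin (n + 1) => a (Fin.castSucc i)) (fun i => ha _)
    obtain ⟨hB0, hB1⟩ := prod_unit_mem (fun i : Fin (n + 1) => 1 - a (Fin.castSucc i))
      (fun i => ⟨by linarith [(ha (Fin.castSucc i)).2], by linarith [(ha (Fin.castSucc i)).1]⟩)
    obtain ⟨hx0, hx1⟩ := ha (Fin.last (n + 1))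
    simp only [Fin.prod_univ_castSucc] at ih' hA0 hA1 hB0 hB1 ⊢
    set A := ∏ i : Fin (n + 1), a (Fin.castSucc i)
    set B := ∏ i : Fin (n + 1), (1 - a (Fin.castSucc i))
    set x := a (Fin.last (n + 1))
    nlinarith [mul_nonneg hA0 (by linarith : (0:ℝ) ≤ 1 - x), mul_nonneg hB0 hx0]

/-- The mirror star `1 − a`. -/
theorem mirror_mem {m : ℕ} (a : Fin m → ℝ) (ha : ∀ i, 0 ≤ a i ∧ a i ≤ 1) :
    ∀ i, 0 ≤ 1 - a i ∧ 1 - a i ≤ 1 :=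
  fun i => ⟨by linarith [(ha i).2], by linarith [(ha i).1]⟩

/-- `B · (1 − A) ≤ P₂ − 1` (mirror of `prod_mul_one_sub_prod_le`). -/
theorem prod_one_sub_mul_one_sub_prod_le {m : ℕ} (a : Fin m → ℝ) (ha : ∀ i, 0 ≤ a i ∧ a i ≤ 1) :
    (∏ i, (1 - a i)) * (1 - ∏ i, a i) ≤ ∏ i, (1 + (1 - a i) ^ 2) - 1 := by
  have := prod_mul_one_sub_prod_le (fun i => 1 - a i) (mirror_mem a ha)
  simpa using this

/-- `P₂ · A ≤ 1` (mirror). -/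
theorem prod_one_add_one_sub_sq_mul_prod_le_one {m : ℕ} (a : Fin m → ℝ) (ha : ∀ i, 0 ≤ a i ∧ a i ≤ 1) :
    (∏ i, (1 + (1 - a i) ^ 2)) * ∏ i, a i ≤ 1 := by
  have := prod_one_add_sq_mul_prod_one_sub_le_one (fun i => 1 - a i) (mirror_mem a ha)
  simpa using this

/-- `1 + B ^ 2 ≤ P₂` (mirror). -/
theorem one_add_prod_one_sub_sq_le {m : ℕ} (a : Fin (m + 1) → ℝ) (ha : ∀ i, 0 ≤ a i ∧ a i ≤ 1) :
    1 + (∏ i, (1 - a i)) ^ 2 ≤ ∏ i, (1 + (1 - a i) ^ 2) := by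
  have := one_add_prod_sq_le (fun i => 1 - a i) (mirror_mem a ha)
  simpa using this

/-- The six coordinates of a pure root: `V a = (1, P₁, P₂, A·B, A, B)`. -/
theorem V_coords {m : ℕ} (a : Fin m → ℝ) :
    V a 0 = 1 ∧ V a 1 = ∏ i, (1 + a i ^ 2) ∧ V a 2 = ∏ i, (1 + (1 - a i) ^ 2)
      ∧ V a 3 = (∏ i, a i) * ∏ i, (1 - a i) ∧ V a 4 = ∏ i, a i ∧ V a 5 = ∏ i, (1 - a i) := by
  refine ⟨?_, ?_, ?_, ?_, ?_, ?_⟩ <;> simp only [V_apply, v] <;> simp [Finset.prod_mul_distrib]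

end TreeClosure

end PercRepro
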